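import Mathlib
import Literature.NumberTheory.LFunctions.Zhang2022.SkeletonPartThree
import Literature.NumberTheory.LFunctions.ZetaRealAxis
import HarnessLib

/-!
# Zhang (2022), §7 part (c): under (A), `ζ(s) ≠ 0` for `Re s > 1 − 2𝓛⁻¹`, `|Im s| ≤ 2D`

Topic `Literature/NumberTheory/LFunctions/Zhang2022` (Landau–Siegel audit tree; verdict-neutral).
Y. Zhang, *Discrete mean estimates and the Landau–Siegel zero*, arXiv:2211.02515v1 (2022)
[Zhang2022LandauSiegel] — **an unrefereed manuscript under adjudication.** Cell siegel-zhang
(D-0069). The wider form of the presupposition of the (7.19) contour move (§7 p. 40, tex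
L2108–L2117, node `Z22:§7.u047`, gap row G-adj2-3): the tree's
`Section7dStatements.zeta_ne_zero_of_assumptionA` (p413466) gives `ζ ≠ 0` on `Re s ≥ 1 − 𝓛⁻¹`,
`|Im s| ≤ D`; the Borel–Carathéodory bound for `ζ⁻¹` ON that line (companion
`Section7ZetaLowerBound.lean`) needs a zero-free DISC around it, i.e. the region
`Re s > 1 − 2𝓛⁻¹`, `|Im s| ≤ 2D` proved here — by the same Deuring–Heilbronn argument (tree
`deuring_heilbronn_holds` for the principal character, from Lemma 5.5's exceptional zero
`Skeleton.lemma55_holds`), whose slack (`log 𝓛 → ∞`) absorbs any fixed width `k𝓛⁻¹`. Theorems only.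

WHAT THIS IS NOT: any statement about Theorems 1–2 of the manuscript or about Landau–Siegel zeros;
CONDITIONAL on (A) exactly as every §§5–18 node of the manuscript.

## References

* Y. Zhang, arXiv:2211.02515v1 (2022), §7 p. 40, tex L2108–L2117; §5 Lemma 5.5.
  [cite: Zhang2022LandauSiegel, §7 p.40]
* E. Bombieri, *Le grand crible dans la théorie analytique des nombres*, Astérisque 18 (1987), §6
  Thm. 14 (Deuring–Heilbronn; tree `deuring_heilbronn_holds`). [cite: Bombieri1987GrandCrible, §6 Thm. 14]
-/

noncomputable section

open Complex Real Metric Set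

namespace Literature.NumberTheory.LFunctions.Zhang2022.ZetaLowerBound

/-! ### The zero-free region of width `2𝓛⁻¹` up to height `2D` (Deuring–Heilbronn under (A)) -/


/-- For every `L₀` there is `D₀` with `𝓛 = log D ≥ max(L₀, 2)` for all `D ≥ D₀`. [folklore] -/
private theorem exists_nat_ell_ge (L₀ : ℝ) :
    ∃ D₀ : ℕ, ∀ D : ℕ, D₀ ≤ D → L₀ ≤ Skeleton.ell D ∧ 2 ≤ Skeleton.ell D := by
  refine ⟨⌈Real.exp (max L₀ 2)⌉₊, fun D hD => ?_⟩
  unfold Skeleton.ell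
  have h1 : Real.exp (max L₀ 2) ≤ D := (Nat.le_ceil _).trans (by exact_mod_cast hD)
  have h2 := Real.log_le_log (Real.exp_pos _) h1
  rw [Real.log_exp] at h2
  exact ⟨(le_max_left _ _).trans h2, (le_max_right _ _).trans h2⟩

/-- **Zero-free region of width `2𝓛⁻¹` under (A)** (the wider form of the presupposition of the
(7.19) contour move, `Z22:§7.u047`; the tree's `Section7dStatements.zeta_ne_zero_of_assumptionA`
is the width-`𝓛⁻¹` version): for `D` large and `χ (mod D)` real primitive with (A), `ζ(s) ≠ 0`
whenever `Re s > 1 − 2𝓛⁻¹` and `|Im s| ≤ 2D`. Deuring–Heilbronn (tree `deuring_heilbronn_holds`)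
for the principal character, from Lemma 5.5's exceptional zero (`Skeleton.lemma55_holds`), exactly
as in the width-`𝓛⁻¹` proof, whose slack (`log 𝓛 → ∞`) absorbs any fixed width `k𝓛⁻¹`.
[cite: Zhang2022LandauSiegel, §7 p.40, tex L2108–L2117] -/
theorem zeta_ne_zero_wide :
    Skeleton.ForAllLarge fun D _ χ => Skeleton.AssumptionA D χ →
      ∀ s : ℂ, 1 - 2 * (Skeleton.ell D)⁻¹ < s.re → |s.im| ≤ 2 * (D : ℝ) → riemannZeta s ≠ 0 := by
  obtain ⟨c₁, c₂, hc₁, hc₂, hDH⟩ := deuring_heilbronn_holds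
  obtain ⟨C₀, D₁, h55⟩ := Skeleton.lemma55_holds
  obtain ⟨C, hCdef⟩ : ∃ C : ℝ, C = max C₀ 1 := ⟨_, rfl⟩
  have hC1 : 1 ≤ C := by rw [hCdef]; exact le_max_right _ _
  have hC0 : 0 < C := by linarith
  have hC₀C : C₀ ≤ C := by rw [hCdef]; exact le_max_left _ _
  obtain ⟨K, hKdef⟩ : ∃ K : ℝ, K = Real.log (c₁ / (3 * C)) := ⟨_, rfl⟩
  obtain ⟨L₀, hL₀def⟩ : ∃ L₀ : ℝ, L₀ = Real.exp ((6 / c₂ + |K|) / 2021 + 1) := ⟨_, rfl⟩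
  obtain ⟨D₂, hD₂⟩ := exists_nat_ell_ge L₀
  refine ⟨max (max D₁ D₂) 3, ?_⟩
  intro D _ χ hD hq hprim hA s hσ ht hζ
  have hD1 : D₁ ≤ D := (le_max_left _ _).trans ((le_max_left _ _).trans hD)
  have hD2 : D₂ ≤ D := (le_max_right _ _).trans ((le_max_left _ _).trans hD)
  have hD3 : 3 ≤ D := (le_max_right _ _).trans hD
  obtain ⟨L, hLdef⟩ : ∃ L : ℝ, L = Skeleton.ell D := ⟨_, rfl⟩
  obtain ⟨hLL₀, hL2⟩ := hD₂ D hD2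
  rw [← hLdef] at hLL₀ hL2 hσ
  have hL0 : 0 < L := by linarith
  have hDr : (3 : ℝ) ≤ D := by exact_mod_cast hD3
  have hD0 : (0 : ℝ) < D := by linarith
  have hLlog : L = Real.log D := by rw [hLdef]; rfl
  have hlogL : (6 / c₂ + |K|) / 2021 + 1 ≤ Real.log L := by
    have h := Real.log_le_log (Real.exp_pos ((6 / c₂ + |K|) / 2021 + 1)) (hL₀def ▸ hLL₀)
    rwa [Real.log_exp] at h
  have hσ1 : s.re < 1 := by
    by_contra h
    exact riemannZeta_ne_zero_of_one_le_re (not_lt.mp h) hζ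
  have hs1 : s ≠ 1 := by
    intro h; rw [h, Complex.one_re] at hσ1; exact lt_irrefl _ hσ1
  have hLinv : 2 * L⁻¹ ≤ 1 := by
    rw [mul_inv_le_iff₀ hL0]; linarith
  have hσ0 : 0 < s.re := by linarith
  obtain ⟨ρt, hρt0, -, hρt1, hρtC, -⟩ := h55 D χ hD1 hq hprim hA
  rw [← hLdef] at hρtC
  have hχ1 : χ ≠ 1 := Skeleton.ne_one_of_isPrimitive_of_three_le hprim hD3
  have hρtlt : ρt < 1 := by
    rcases lt_or_eq_of_le (show ρt ≤ 1 by linarith) with h | h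
    · exact h
    · exfalso
      apply DirichletCharacter.LFunction_apply_one_ne_zero hχ1
      have e : ((ρt : ℝ) : ℂ) = 1 := by rw [h]; simp
      rw [← e]; exact hρt0
  have h1ρ : 0 < 1 - ρt := by linarith
  have h1ρC : 1 - ρt ≤ C * (L ^ 2022)⁻¹ := hρtC.trans (by gcongr)
  have hsρ : s ≠ (ρt : ℂ) := by
    intro h
    have hre : s.re = ρt := by rw [h]; simp
    have hpos : 0 < ρt := hre ▸ hσ0
    exact riemannZeta_ofReal_ne_zero_of_pos_of_lt_one ρt hpos hρtlt (h ▸ hζ)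
  have hLone : (1 : DirichletCharacter ℂ D).LFunction s = 0 := by
    show DirichletCharacter.LFunctionTrivChar D s = 0
    rw [DirichletCharacter.LFunctionTrivChar_eq_mul_riemannZeta hs1, hζ, mul_zero]
  have hDHs := hDH D χ hq ρt hρtlt hρt0 1 s hLone hσ0 hσ1 hsρ
  obtain ⟨Λ, hΛdef⟩ : ∃ Λ : ℝ, Λ = Real.log (D * (2 + |s.im|)) := ⟨_, rfl⟩
  rw [← hΛdef] at hDHs
  have h2t : 2 ≤ 2 + |s.im| := by linarith [abs_nonneg s.im]
  have hDt : (D : ℝ) ≤ D * (2 + |s.im|) := by nlinarith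
  have hΛL : L ≤ Λ := by rw [hΛdef, hLlog]; exact Real.log_le_log hD0 hDt
  have hΛ0 : 0 < Λ := by linarith
  have hΛ3 : Λ ≤ 3 * L := by
    have h1 : D * (2 + |s.im|) ≤ (D : ℝ) ^ 3 := by
      have : 2 + |s.im| ≤ (D : ℝ) * D := by nlinarith
      calc (D : ℝ) * (2 + |s.im|) ≤ D * (D * D) := by gcongr
        _ = (D : ℝ) ^ 3 := by ring
    rw [hΛdef, hLlog]
    calc Real.log (D * (2 + |s.im|)) ≤ Real.log ((D : ℝ) ^ 3) :=
          Real.log_le_log (by positivity) h1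
      _ = 3 * Real.log D := by rw [Real.log_pow]; norm_num
  have hprod : (1 - ρt) * Λ ≤ 3 * C / L ^ 2021 := by
    calc (1 - ρt) * Λ ≤ C * (L ^ 2022)⁻¹ * (3 * L) := by gcongr
      _ = 3 * C / L ^ 2021 := by field_simp
  have hprod0 : 0 < (1 - ρt) * Λ := mul_pos h1ρ hΛ0
  have hX : c₁ / (3 * C) * L ^ 2021 ≤ c₁ / ((1 - ρt) * Λ) := by
    rw [div_mul_eq_mul_div, div_le_div_iff₀ (by positivity) hprod0]
    calc c₁ * L ^ 2021 * ((1 - ρt) * Λ) ≤ c₁ * L ^ 2021 * (3 * C / L ^ 2021) := by gcongr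
      _ = c₁ * (3 * C) := by field_simp
  have hlogX : K + 2021 * Real.log L ≤ Real.log (c₁ / ((1 - ρt) * Λ)) := by
    have hpos : 0 < c₁ / (3 * C) * L ^ 2021 := by positivity
    calc K + 2021 * Real.log L = Real.log (c₁ / (3 * C) * L ^ 2021) := by
          rw [hKdef, Real.log_mul (by positivity) (by positivity), Real.log_pow]; norm_num
      _ ≤ Real.log (c₁ / ((1 - ρt) * Λ)) := Real.log_le_log hpos hX
  have hlogL1 : 1 ≤ Real.log L := by
    have : 0 ≤ (6 / c₂ + |K|) / 2021 := by positivity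
    linarith
  have hnum : 6 / c₂ < K + 2021 * Real.log L := by
    have hK : -|K| ≤ K := neg_abs_le K
    have h2021 : (6 / c₂ + |K|) + 2021 ≤ 2021 * Real.log L := by
      have := mul_le_mul_of_nonneg_left hlogL (by norm_num : (0:ℝ) ≤ 2021)
      linarith
    linarith
  have hnum0 : 0 < K + 2021 * Real.log L := lt_trans (by positivity) hnum
  have hkey : 2 * L⁻¹ < c₂ * Real.log (c₁ / ((1 - ρt) * Λ)) / Λ := by
    have h1 : c₂ * (K + 2021 * Real.log L) / (3 * L) ≤
        c₂ * Real.log (c₁ / ((1 - ρt) * Λ)) / Λ := by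
      rw [div_le_div_iff₀ (by positivity) hΛ0]
      calc c₂ * (K + 2021 * Real.log L) * Λ ≤ c₂ * (K + 2021 * Real.log L) * (3 * L) := by
            gcongr
        _ = c₂ * (3 * L) * (K + 2021 * Real.log L) := by ring
        _ ≤ c₂ * (3 * L) * Real.log (c₁ / ((1 - ρt) * Λ)) := by gcongr
        _ = c₂ * Real.log (c₁ / ((1 - ρt) * Λ)) * (3 * L) := by ring
    refine lt_of_lt_of_le ?_ h1
    rw [show 2 * L⁻¹ = 2 / L by rw [div_eq_mul_inv], div_lt_div_iff₀ hL0 (by positivity)]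
    have : 6 < c₂ * (K + 2021 * Real.log L) := by
      have := (div_lt_iff₀' hc₂).mp hnum
      linarith
    nlinarith
  linarith

end Literature.NumberTheory.LFunctions.Zhang2022.ZetaLowerBound
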